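import Summits.PneNP.PneNP.Theorems.NegLimitedAmplifiedWindowDefs
import Summits.PneNP.PneNP.Theorems.NegLimitedDoorFKGMixtures
import Literature.Computability.Complexity.CliqueTestGraphs
import Mathlib
import HarnessLib

/-!
# Route NegLimited — line `amplified-window`, stub `stub_engineAssembly` (rung F-N1/p3, ROUND-11)

Registered stub (EA) of the skeleton `amplified-window` on the door item
`NegLimited.NeglimitedEpsLogNegationsR` (stmt-PneNP-19860; HOME/pnp-ideate-p3/r11/amplified-window.lean
v2 sha c828757ca2bc7a67; card r11/amplified-window.md §Stubs 4):

  `EngineAssembly := CriticalWindowHardness → MonotoneAmplification → AmplifiedCliqueCorrelation`.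

Given the base hardness (B: `β`, and for the exponent `c' := 3c + e + 2` a clique size `k` and,
eventually in `n`, an exactly balanced FKG-lattice weight `μ` on the edge cube of `K_n` under which
`CLIQUE(n,k)` is `β`-hard for size-`n^{c'}` monotone circuits) and the amplifier (A: `α, e`, and for
`β` a constant `K`), the engine's output (E) with `ε := α/4` is assembled from:
* `prodWeight_fkg` — the product weight `μ^{⊗3^d}` is FKG-lattice (`NegLimitedDoor.fkg_blockProduct`,
  p462271), nonnegative (`prodWeight_nonneg`);
* `massAt_prodWeight_ampFn` — EXACT BALANCE of `RM3_d ⊗ f` under `D^{⊗3^d}` when `f` has both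
  `D`-masses `½`: push the product weight forward to the leaf bits (curry, fibre decomposition
  `Finset.sum_fiberwise`, `Finset.prod_univ_sum`), where it is `(½)^{3^d}·#{leaf patterns with RM3 = b}`,
  and `RM3` is self-dual (`recMaj3_not`) so exactly half of the patterns give each value
  (`two_mul_card_filter_recMaj3`);
* size bookkeeping `ampLen n k ≤ 2n³`, `3^{⌊log₃ n⌋} ≤ n`, so `ℓ^c·K·(3^d)^e ≤ n^{3c+e+2}` once
  `2^c K ≤ n`; exponent bookkeeping `K·(3^d)^{−α} ≤ K·3^α·n^{−α} ≤ (2n³)^{−α/4} ≤ ℓ^{−α/4}` once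
  `K·3^α·2^{α/4} ≤ n^{α/4}` (`3^d > n/3`); both eventually in `n` (`tendsto_rpow_atTop`).

HONEST FRAMING: pure assembly (zero new mathematics); the line's load-bearing stubs
`stub_criticalWindow` (B) and `stub_monotoneAmplification` (A) are NOT proved here and remain open;
FRONTIER rung F-N1 — nothing here bears on P vs NP.
-/

set_option linter.dupNamespace false -- `Summit.PneNP.PneNP.…`: summit = sub-problem name (D-0017 single-conjunct layout)

namespace Summit.PneNP.PneNP.Theorems.NegLimitedAmplifiedWindow

open Finset Filter
open Literature.Computability.Complexity
open Summit.PneNP.PneNP.Theorems.NegLimitedDoor (massAt agreeAt)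

/-! ### The product weight: FKG-lattice, total mass -/

/-- The product weight of an FKG-lattice weight is FKG-lattice (coordinatewise `⊓/⊔`;
`NegLimitedDoor.fkg_blockProduct`). -/
theorem prodWeight_fkg {ι : Type} (d : ℕ) {D : (ι → Bool) → ℝ} (hD0 : ∀ z, 0 ≤ D z)
    (hD : ∀ z z', D z * D z' ≤ D (z ⊓ z') * D (z ⊔ z')) (x y : (Fin d → Fin 3) × ι → Bool) :
    prodWeight d D x * prodWeight d D y ≤ prodWeight d D (x ⊓ y) * prodWeight d D (x ⊔ y) :=
  Summit.PneNP.PneNP.Theorems.NegLimitedDoor.fkg_blockProduct D hD0 hD x y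

/-- `massAt` as a filtered sum. -/
theorem massAt_eq_sum_filter' {α : Type*} [Fintype α] (μ : α → ℝ) (f : α → Bool) (b : Bool) :
    massAt μ f b = ∑ x ∈ univ.filter (fun x => f x = b), μ x := by
  rw [Summit.PneNP.PneNP.Theorems.NegLimitedDoor.massAt, sum_filter]

/-! ### Exact balance of `RM3_d ⊗ f` under the product weight -/

/-- Self-duality count: exactly half of the leaf patterns have `RM3_d = b`. -/
theorem two_mul_card_filter_recMaj3 (d : ℕ) (b : Bool) :
    2 * #(univ.filter fun bv : (Fin d → Fin 3) → Bool => recMaj3 d bv = b) =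
      Fintype.card ((Fin d → Fin 3) → Bool) := by
  classical
  have hcompl : #(univ.filter fun bv : (Fin d → Fin 3) → Bool => recMaj3 d bv = b) =
      #(univ.filter fun bv : (Fin d → Fin 3) → Bool => recMaj3 d bv = !b) := by
    refine card_bij (fun bv _ => fun w => !bv w) ?_ ?_ ?_
    · intro bv hbv
      simp only [mem_filter, mem_univ, true_and] at hbv ⊢
      rw [recMaj3_not, hbv]
    · intro a _ a' _ h
      funext w
      have := congrFun h w
      simpa using this
    · intro bv hbv
      refine ⟨fun w => !bv w, ?_, ?_⟩
      · simp only [mem_filter, mem_univ, true_and] at hbv ⊢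
        rw [recMaj3_not, hbv, Bool.not_not]
      · funext w
        simp
  have htot := card_filter_add_card_filter_not
    (s := (univ : Finset ((Fin d → Fin 3) → Bool))) (fun bv => recMaj3 d bv = b)
  have hneg : (univ.filter fun bv : (Fin d → Fin 3) → Bool => ¬ recMaj3 d bv = b) =
      univ.filter fun bv => recMaj3 d bv = !b := by
    ext bv
    simp only [mem_filter, mem_univ, true_and]
    cases recMaj3 d bv <;> cases b <;> simp
  rw [hneg, ← hcompl, card_univ] at htot
  omega

/-- **Exact balance.**  If `f` has `D`-mass `½` on each value, then `RM3_d ⊗ f` has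
`D^{⊗3^d}`-mass `½` on each value. -/
theorem massAt_prodWeight_ampFn {ι : Type} [Fintype ι] [DecidableEq ι] (d : ℕ) (D : (ι → Bool) → ℝ)
    (f : (ι → Bool) → Bool) (ht : massAt D f true = 1 / 2) (hf : massAt D f false = 1 / 2)
    (b : Bool) : massAt (prodWeight d D) (ampFn d f) b = 1 / 2 := by
  classical
  have hmass : ∀ b' : Bool, ∑ z ∈ univ.filter (fun z => f z = b'), D z = 1 / 2 := by
    intro b'
    rw [← massAt_eq_sum_filter']
    cases b'
    · exact hf
    · exact ht
  -- Step 1: indicator form and currying.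
  have h1 : massAt (prodWeight d D) (ampFn d f) b =
      ∑ x : (Fin d → Fin 3) × ι → Bool,
        prodWeight d D x * (if ampFn d f x = b then (1 : ℝ) else 0) := by
    rw [Summit.PneNP.PneNP.Theorems.NegLimitedDoor.massAt]
    refine sum_congr rfl fun x _ => ?_
    split_ifs <;> simp
  have h2 : ∑ x : (Fin d → Fin 3) × ι → Bool,
        prodWeight d D x * (if ampFn d f x = b then (1 : ℝ) else 0) =
      ∑ g : (Fin d → Fin 3) → ι → Bool,
        (∏ w, D (g w)) * (if recMaj3 d (fun w => f (g w)) = b then (1 : ℝ) else 0) :=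
    Fintype.sum_equiv (Equiv.curry (Fin d → Fin 3) ι Bool) _ _ (fun x => rfl)
  -- Step 2: fibre decomposition along the leaf bits.
  have h3 := (Finset.sum_fiberwise (univ : Finset ((Fin d → Fin 3) → ι → Bool))
    (fun g => fun w => f (g w))
    (fun g => (∏ w, D (g w)) * (if recMaj3 d (fun w => f (g w)) = b then (1 : ℝ) else 0))).symm
  have hfib : ∀ bv : (Fin d → Fin 3) → Bool,
      (univ.filter fun g : (Fin d → Fin 3) → ι → Bool => (fun w => f (g w)) = bv) =
        Fintype.piFinset (fun w => univ.filter fun z => f z = bv w) := by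
    intro bv
    ext g
    simp only [mem_filter, mem_univ, true_and, Fintype.mem_piFinset]
    constructor
    · intro h w
      exact congrFun h w
    · intro h
      funext w
      exact h w
  have hinner : ∀ bv : (Fin d → Fin 3) → Bool,
      ∑ g ∈ univ.filter (fun g : (Fin d → Fin 3) → ι → Bool => (fun w => f (g w)) = bv),
        (∏ w, D (g w)) * (if recMaj3 d (fun w => f (g w)) = b then (1 : ℝ) else 0) =
      (if recMaj3 d bv = b then (1 : ℝ) else 0) * (1 / 2) ^ Fintype.card (Fin d → Fin 3) := by
    intro bv
    have hrw : ∀ g ∈ univ.filter (fun g : (Fin d → Fin 3) → ι → Bool => (fun w => f (g w)) = bv),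
        (∏ w, D (g w)) * (if recMaj3 d (fun w => f (g w)) = b then (1 : ℝ) else 0) =
        (if recMaj3 d bv = b then (1 : ℝ) else 0) * ∏ w, D (g w) := by
      intro g hg
      rw [(mem_filter.mp hg).2, mul_comm]
    rw [sum_congr rfl hrw, ← mul_sum, hfib, ← Finset.prod_univ_sum]
    congr 1
    rw [Finset.prod_congr rfl fun w _ => hmass (bv w), prod_const, card_univ]
  -- Step 3: count the leaf patterns.
  have hcard : (2 : ℝ) * #(univ.filter fun bv : (Fin d → Fin 3) → Bool => recMaj3 d bv = b) =
      (2 : ℝ) ^ Fintype.card (Fin d → Fin 3) := by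
    have h := two_mul_card_filter_recMaj3 d b
    rw [Fintype.card_fun, Fintype.card_bool] at h
    exact_mod_cast h
  rw [h1, h2, h3, sum_congr rfl fun bv _ => hinner bv, ← sum_mul, sum_boole]
  have hpow : ((1 : ℝ) / 2) ^ Fintype.card (Fin d → Fin 3) * (2 : ℝ) ^ Fintype.card (Fin d → Fin 3) = 1 := by
    rw [← mul_pow]
    norm_num
  have : (#(univ.filter fun bv : (Fin d → Fin 3) → Bool => recMaj3 d bv = b) : ℝ) =
      (2 : ℝ) ^ Fintype.card (Fin d → Fin 3) / 2 := by
    linarith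
  rw [this]
  calc (2 : ℝ) ^ Fintype.card (Fin d → Fin 3) / 2 * (1 / 2) ^ Fintype.card (Fin d → Fin 3)
      = ((1 : ℝ) / 2) ^ Fintype.card (Fin d → Fin 3) * (2 : ℝ) ^ Fintype.card (Fin d → Fin 3) / 2 := by
        ring
    _ = 1 / 2 := by rw [hpow]

/-! ### Size and exponent bookkeeping -/

/-- `ampLen n k ≤ 2 n³` for `k < n`. -/
theorem ampLen_le (n k : ℕ) (hkn : k < n) : ampLen n k ≤ 2 * n ^ 3 := by
  unfold ampLen
  have hn : n ≠ 0 := by omega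
  have h3 : 3 ^ Nat.log 3 n ≤ n := Nat.pow_log_le_self 3 hn
  have h1 : 3 ^ Nat.log 3 n * (n * n) ≤ n * (n * n) := Nat.mul_le_mul_right _ h3
  have h2 : k ≤ n * (n * n) := by nlinarith
  nlinarith

/-- `1 ≤ ampLen n k` for `1 ≤ n`. -/
theorem one_le_ampLen (n k : ℕ) (hn : 1 ≤ n) : 1 ≤ ampLen n k := by
  unfold ampLen
  have h1 : 1 ≤ 3 ^ Nat.log 3 n := Nat.one_le_pow _ _ (by norm_num)
  nlinarith

/-- `n < 3 · 3^{⌊log₃ n⌋}`. -/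
theorem lt_three_mul_pow_log (n : ℕ) : n < 3 * 3 ^ Nat.log 3 n := by
  have := Nat.lt_pow_succ_log_self (b := 3) (by norm_num) n
  rw [pow_succ] at this
  linarith

/-- The size bookkeeping: `ℓ^c · K · (3^d)^e ≤ n^{3c+e+2}` once `2^c K ≤ n` (`ℓ = ampLen n k ≤ 2n³`,
`3^d ≤ n`). -/
theorem size_bookkeeping {c e n k s : ℕ} {K : ℝ} (hK : 0 < K) (hkn : k < n)
    (hKn : (2 : ℝ) ^ c * K ≤ n) (hs : s ≤ ampLen n k ^ c) :
    (s : ℝ) * K * ((3 : ℝ) ^ Nat.log 3 n) ^ e ≤ ((n ^ (3 * c + e + 2) : ℕ) : ℝ) := by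
  have hn1 : 1 ≤ n := by omega
  have hn : (1 : ℝ) ≤ n := by exact_mod_cast hn1
  have hℓ : (ampLen n k : ℝ) ≤ 2 * (n : ℝ) ^ 3 := by exact_mod_cast ampLen_le n k hkn
  have h3 : (3 : ℝ) ^ Nat.log 3 n ≤ n := by
    have := Nat.pow_log_le_self 3 (show n ≠ 0 by omega)
    exact_mod_cast this
  have hs' : (s : ℝ) ≤ (ampLen n k : ℝ) ^ c := by exact_mod_cast hs
  push_cast
  calc (s : ℝ) * K * ((3 : ℝ) ^ Nat.log 3 n) ^ e
      ≤ (2 * (n : ℝ) ^ 3) ^ c * K * (n : ℝ) ^ e := by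
        gcongr
        exact hs'.trans (pow_le_pow_left₀ (by positivity) hℓ c)
    _ = (2 : ℝ) ^ c * K * (n : ℝ) ^ (3 * c + e) := by ring
    _ ≤ (n : ℝ) * (n : ℝ) ^ (3 * c + e) := by gcongr
    _ = (n : ℝ) ^ (3 * c + e + 1) := by ring
    _ ≤ (n : ℝ) ^ (3 * c + e + 2) := pow_le_pow_right₀ hn (by omega)

/-- The exponent bookkeeping: `K·(3^d)^{−α} ≤ ℓ^{−α/4}` once `K·3^α·2^{α/4} ≤ n^{α/4}`. -/
theorem exponent_bookkeeping {α K : ℝ} (hα : 0 < α) (hK : 0 < K) {n k : ℕ} (hkn : k < n)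
    (hn : K * (3 : ℝ) ^ α * (2 : ℝ) ^ (α / 4) ≤ (n : ℝ) ^ (α / 4)) :
    K * ((3 : ℝ) ^ Nat.log 3 n) ^ (-α) ≤ ((ampLen n k : ℕ) : ℝ) ^ (-(α / 4)) := by
  have hn1 : 1 ≤ n := by omega
  have hnpos : (0 : ℝ) < n := by exact_mod_cast hn1
  have hℓpos : (0 : ℝ) < (ampLen n k : ℕ) := by exact_mod_cast one_le_ampLen n k hn1
  have hℓ : ((ampLen n k : ℕ) : ℝ) ≤ 2 * (n : ℝ) ^ 3 := by exact_mod_cast ampLen_le n k hkn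
  -- `3^d > n/3`
  have hd : (n : ℝ) / 3 ≤ (3 : ℝ) ^ Nat.log 3 n := by
    have h := lt_three_mul_pow_log n
    have h' : (n : ℝ) < 3 * (3 : ℝ) ^ Nat.log 3 n := by exact_mod_cast h
    linarith
  have hdpos : (0 : ℝ) < (n : ℝ) / 3 := by positivity
  -- left side ≤ K · 3^α · n^{−α}
  have hL : K * ((3 : ℝ) ^ Nat.log 3 n) ^ (-α) ≤ K * ((3 : ℝ) ^ α * (n : ℝ) ^ (-α)) := by
    refine mul_le_mul_of_nonneg_left ?_ hK.le
    calc ((3 : ℝ) ^ Nat.log 3 n) ^ (-α) ≤ ((n : ℝ) / 3) ^ (-α) :=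
          Real.rpow_le_rpow_of_nonpos hdpos hd (by linarith)
      _ = (3 : ℝ) ^ α * (n : ℝ) ^ (-α) := by
          rw [Real.div_rpow hnpos.le (by norm_num), Real.rpow_neg (by norm_num : (0 : ℝ) ≤ 3),
            Real.rpow_neg hnpos.le]
          field_simp
  -- right side ≥ 2^{−α/4} · n^{−3α/4}
  have hR : (2 : ℝ) ^ (-(α / 4)) * (n : ℝ) ^ (-(3 * α / 4)) ≤ ((ampLen n k : ℕ) : ℝ) ^ (-(α / 4)) := by
    calc (2 : ℝ) ^ (-(α / 4)) * (n : ℝ) ^ (-(3 * α / 4))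
        = (2 * (n : ℝ) ^ 3) ^ (-(α / 4)) := by
          rw [Real.mul_rpow (by norm_num) (by positivity)]
          congr 1
          rw [← Real.rpow_natCast, ← Real.rpow_mul hnpos.le]
          congr 1
          push_cast
          ring
      _ ≤ ((ampLen n k : ℕ) : ℝ) ^ (-(α / 4)) :=
          Real.rpow_le_rpow_of_nonpos hℓpos hℓ (by linarith)
  -- compare the two bounds using `hn`
  have hmid : K * ((3 : ℝ) ^ α * (n : ℝ) ^ (-α)) ≤ (2 : ℝ) ^ (-(α / 4)) * (n : ℝ) ^ (-(3 * α / 4)) := by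
    have e1 : (n : ℝ) ^ (-α) = (n : ℝ) ^ (-(3 * α / 4)) * ((n : ℝ) ^ (α / 4))⁻¹ := by
      rw [← Real.rpow_neg hnpos.le, ← Real.rpow_add hnpos]
      congr 1
      ring
    have e2 : (2 : ℝ) ^ (-(α / 4)) = ((2 : ℝ) ^ (α / 4))⁻¹ := Real.rpow_neg (by norm_num) _
    have hnα : 0 < (n : ℝ) ^ (α / 4) := Real.rpow_pos_of_pos hnpos _
    have h2α : 0 < (2 : ℝ) ^ (α / 4) := Real.rpow_pos_of_pos (by norm_num) _
    have hn34 : 0 < (n : ℝ) ^ (-(3 * α / 4)) := Real.rpow_pos_of_pos hnpos _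
    rw [e1, e2]
    rw [show K * ((3 : ℝ) ^ α * ((n : ℝ) ^ (-(3 * α / 4)) * ((n : ℝ) ^ (α / 4))⁻¹)) =
        (K * (3 : ℝ) ^ α / (n : ℝ) ^ (α / 4)) * (n : ℝ) ^ (-(3 * α / 4)) by ring]
    rw [show ((2 : ℝ) ^ (α / 4))⁻¹ * (n : ℝ) ^ (-(3 * α / 4)) =
        (1 / (2 : ℝ) ^ (α / 4)) * (n : ℝ) ^ (-(3 * α / 4)) by ring]
    refine mul_le_mul_of_nonneg_right ?_ hn34.le
    rw [div_le_div_iff₀ hnα h2α, one_mul]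
    exact hn
  exact hL.trans (hmid.trans hR)

/-! ### The stub -/

/-- **Registered stub `stub_engineAssembly`** of the skeleton `amplified-window` (stmt-PneNP-19860):
base hardness (B) + monotone amplification (A) ⟹ the engine's output (E), with `ε := α/4` and the
base invoked at exponent `c' := 3c + e + 2`. -/
theorem stub_engineAssembly : EngineAssembly := by
  intro hB hA
  obtain ⟨β, hβ, hBc⟩ := hB
  obtain ⟨α, hα, e, hAβ⟩ := hA
  obtain ⟨K, hK, hAK⟩ := hAβ β hβ
  refine ⟨α / 4, by positivity, fun c => ?_⟩
  obtain ⟨k, hk3, hev⟩ := hBc (3 * c + e + 2)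
  refine ⟨k, hk3, ?_⟩
  -- eventual numeric facts
  have hev1 : ∀ᶠ n : ℕ in atTop, k < n := eventually_gt_atTop k
  have hev2 : ∀ᶠ n : ℕ in atTop, (2 : ℝ) ^ c * K ≤ n := by
    have h := tendsto_natCast_atTop_atTop (R := ℝ)
    exact h.eventually_ge_atTop _
  have hev3 : ∀ᶠ n : ℕ in atTop, K * (3 : ℝ) ^ α * (2 : ℝ) ^ (α / 4) ≤ (n : ℝ) ^ (α / 4) := by
    have h := (tendsto_rpow_atTop (show 0 < α / 4 by positivity)).comp
      (tendsto_natCast_atTop_atTop (R := ℝ))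
    exact h.eventually_ge_atTop _
  filter_upwards [hev, hev1, hev2, hev3] with n hμ hkn hKn hexp
  obtain ⟨μ, hμ0, hμfkg, hμt, hμf, hhard⟩ := hμ
  have hmono : Monotone (cliqueFn n k) := cliqueFn_monotone_holds n k
  have hmass1 : ∑ z, μ z = 1 := by
    rw [← Summit.PneNP.PneNP.Theorems.NegLimitedDoor.massAt_false_add_massAt_true μ (cliqueFn n k),
      hμf, hμt]
    norm_num
  refine ⟨ampFn_monotone _ hmono, prodWeight (Nat.log 3 n) μ, prodWeight_nonneg _ hμ0,
    prodWeight_fkg _ hμ0 hμfkg, massAt_prodWeight_ampFn _ μ _ hμt hμf true,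
    massAt_prodWeight_ampFn _ μ _ hμt hμf false, fun M hM hMs => ?_⟩
  have hsize : (M.size : ℝ) * K * ((3 : ℝ) ^ Nat.log 3 n) ^ e ≤ ((n ^ (3 * c + e + 2) : ℕ) : ℝ) :=
    size_bookkeeping hK hkn hKn hMs
  have hAn := hAK (Edge n) μ (cliqueFn n k) (n ^ (3 * c + e + 2)) (Nat.log 3 n) hμ0 hmass1 hmono hμt
    hhard M hM hsize
  exact hAn.trans (by linarith [exponent_bookkeeping hα hK hkn hexp])

end Summit.PneNP.PneNP.Theorems.NegLimitedAmplifiedWindow
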